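import Summits.BirchSwinnertonDyer.BirchSwinnertonDyer.Statement
import Literature.NumberTheory.EllipticCurves.LeadingTerm
import Literature.NumberTheory.EllipticCurves.Selmer
import Literature.NumberTheory.EllipticCurves.SelmerCorankHolds
import Literature.NumberTheory.EllipticCurves.KatoRankBound
import Literature.NumberTheory.EllipticCurves.PAdicLFunctionOrderParityProofs
import HarnessLib

/-!
# SoloInformedFirstInstances — the first open instances of each side of RANK, and the symmetry of the doors

Kernel-checked bookkeeping (logic over named Literature facts taken as hypotheses) complementing
`SoloInformedOpenCore`, `SoloInformedRankTwo` and `SoloInformedConverseLadder`: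

* `soloInformed_ub_iff_points_force_vanishing`, `soloInformed_lb_iff_vanishing_forces_points`:
  the upper inequality `rank ≤ r_an` is literally "`k` independent points force `ord_{s=1} L ≥ k`",
  the lower one is "`ord_{s=1} L ≥ k` forces `k` independent points".
* `soloInformed_two_le_analyticRank_of_two_le_rank`: over Gross–Zagier–Kolyvagin the instance
  `k = 2` of points-force-vanishing is known; `soloInformed_ubTwo_iff_three_points`: the FIRST OPEN
  instance of the upper side, `r_an = 2 ⇒ rank ≤ 2`, is equivalent to "three independent rational
  points force `L''(E,1) = 0`".
* `soloInformed_points_force_padic_vanishing`: the `p`-adic analogue of points-force-vanishing is a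
  theorem for every `k` (Kato's `corank Sel_{p^∞} ≤ ord_T L_p` and the corank identity), which is
  why door (α) "p-adic order ≤ complex order" is exactly what the upper side lacks.
* `soloInformed_sha_zero_and_rank_eq_of_cap_of_lb`, `soloInformed_lb_of_sha_zero_of_selmer_lb`,
  `soloInformed_doors_symmetry`: with `c_p = corank Sel_{p^∞}`, `s_p = corank Ш[p^∞]`:
  (α) `c_p ≤ r_an` together with the lower inequality gives (β) `s_p = 0` AND `rank = r_an`;
  (β) together with a Selmer lower bound `r_an ≤ c_p` gives the lower inequality; and once
  `c_p = r_an` is pinned (door (α) plus the converse ladder and parity), RANK at `E` ⟺ (β) at `p`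
  ⟺ the lower inequality at `E`. So for `r_an ≤ 3` the conjecture separates into an ANALYTIC
  statement (`c_p = r_an`, whose only open part is (α)) and an ARITHMETIC one
  (`Ш(E/ℚ)[p^∞]` finite at one prime ⟺ `r_an` independent points exist).

solo-BirchSwinnertonDyer-informed (session 2). No new definitions.
-/

open scoped Classical

open Literature.NumberTheory.EllipticCurves Literature.NumberTheory.EllipticCurves.ModularForms

namespace Summit.BirchSwinnertonDyer.BirchSwinnertonDyer.Theorems

/-! ### The two sides as points-versus-vanishing statements -/

/-- **Upper side = points force vanishing.** `rank ≤ r_an` for all `E/ℚ` iff for all `E/ℚ` and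
all `k`, `k` independent rational points force `ord_{s=1} L(E,s) ≥ k`. [folklore] -/
theorem soloInformed_ub_iff_points_force_vanishing :
    (∀ (W : WeierstrassCurve ℚ) [W.IsElliptic], W.mordellWeilRank ≤ W.analyticRank) ↔
    (∀ (W : WeierstrassCurve ℚ) [W.IsElliptic] (k : ℕ),
      k ≤ W.mordellWeilRank → k ≤ W.analyticRank) := by
  constructor
  · intro h W hW k hk
    exact hk.trans (h W)
  · intro h W hW
    exact h W _ le_rfl

/-- **Lower side = vanishing forces points.** `r_an ≤ rank` for all `E/ℚ` iff for all `E/ℚ` and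
all `k`, `ord_{s=1} L(E,s) ≥ k` forces `k` independent rational points. Its first open instance is
already `k = 1` inside `r_an ≥ 2`: "`L(E,1) = L'(E,1) = 0 ⇒ E(ℚ)` is infinite". [folklore] -/
theorem soloInformed_lb_iff_vanishing_forces_points :
    (∀ (W : WeierstrassCurve ℚ) [W.IsElliptic], W.analyticRank ≤ W.mordellWeilRank) ↔
    (∀ (W : WeierstrassCurve ℚ) [W.IsElliptic] (k : ℕ),
      k ≤ W.analyticRank → k ≤ W.mordellWeilRank) := by
  constructor
  · intro h W hW k hk
    exact hk.trans (h W)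
  · intro h W hW
    exact h W _ le_rfl

/-- **Known instance `k = 2` of points-force-vanishing** (contrapositive of Gross–Zagier–Kolyvagin,
tree fact `rank_eq_analyticRank_of_analyticRank_le_one`; Gross, PCMS 18 (2011) Thm. 3.3):
two independent rational points force `L(E,1) = L'(E,1) = 0`. [cite: GrossPCMS2011, Thm. 3.3] -/
theorem soloInformed_two_le_analyticRank_of_two_le_rank
    (hGZK : rank_eq_analyticRank_of_analyticRank_le_one)
    (W : WeierstrassCurve ℚ) [W.IsElliptic] (h : 2 ≤ W.mordellWeilRank) :
    2 ≤ W.analyticRank := by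
  by_contra hlt
  push Not at hlt
  have h1 : W.mordellWeilRank = W.analyticRank := (hGZK W (by omega)).1
  omega

/-- **First open instance of the upper side.** Over Gross–Zagier–Kolyvagin, `UB₂|_{r_an = 2}`
(`r_an(E) = 2 ⇒ rank E(ℚ) ≤ 2` for all `E/ℚ`) is EQUIVALENT to: three independent rational points
force `L''(E,1) = 0` (i.e. `rank ≥ 3 ⇒ r_an ≥ 3`). The parity conjecture for Mordell–Weil ranks
(not known) would only exclude `rank = 3`, not `rank = 4`, at `r_an = 2`. [cite: GrossPCMS2011, Thm. 3.3] -/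
theorem soloInformed_ubTwo_iff_three_points
    (hGZK : rank_eq_analyticRank_of_analyticRank_le_one) :
    (∀ (W : WeierstrassCurve ℚ) [W.IsElliptic], W.analyticRank = 2 → W.mordellWeilRank ≤ 2) ↔
    (∀ (W : WeierstrassCurve ℚ) [W.IsElliptic], 3 ≤ W.mordellWeilRank → 3 ≤ W.analyticRank) := by
  constructor
  · intro h W hW h3
    have h2 : 2 ≤ W.analyticRank :=
      soloInformed_two_le_analyticRank_of_two_le_rank hGZK W (by omega)
    by_contra hlt
    push Not at hlt
    have hle : W.mordellWeilRank ≤ 2 := h W (by omega)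
    omega
  · intro h W hW h2
    by_contra hgt
    push Not at hgt
    have h3 : 3 ≤ W.analyticRank := h W (by omega)
    omega

/-- **General form**: over Gross–Zagier–Kolyvagin, the upper side for all curves is equivalent to
"for every `r ≥ 2`, `r + 1` independent points force `ord_{s=1} L ≥ r + 1`". [cite: GrossPCMS2011, Thm. 3.3] -/
theorem soloInformed_ub_iff_succ_points_force_vanishing
    (hGZK : rank_eq_analyticRank_of_analyticRank_le_one) :
    (∀ (W : WeierstrassCurve ℚ) [W.IsElliptic], W.mordellWeilRank ≤ W.analyticRank) ↔
    (∀ (W : WeierstrassCurve ℚ) [W.IsElliptic] (r : ℕ), 2 ≤ r →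
      r + 1 ≤ W.mordellWeilRank → r + 1 ≤ W.analyticRank) := by
  constructor
  · intro h W hW r _ hk
    exact hk.trans (h W)
  · intro h W hW
    by_contra hlt
    push Not at hlt
    -- `r_an < rank`; if `r_an ≤ 1` GZK gives equality, else apply `h` with `r = r_an`.
    by_cases h1 : W.analyticRank ≤ 1
    · have := (hGZK W h1).1
      omega
    · have key := h W W.analyticRank (by omega) (by omega)
      omega

/-! ### The p-adic analogue of points-force-vanishing is known -/

/-- **Points force p-adic vanishing, every order** (Kato, Astérisque 295 (2004), Thm. 18.4, as the
tree fact `kato_selmerCorank_le_order_padicLFunction`, plus the corank identity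
`corank Sel_{p^∞} = rank + corank Ш[p^∞]`, a tree theorem): for a globally minimal `E/ℚ`, an odd
good ordinary `p` and the newform `f` of `E`, `k` independent rational points force
`ord_{T=0} L_p(E,T) ≥ k`. The archimedean counterpart is open from `k = 3` on
(`soloInformed_ubTwo_iff_three_points`). [cite: Kato2004, Thm 18.4] -/
theorem soloInformed_points_force_padic_vanishing
    (W : WeierstrassCurve ℚ) [W.IsElliptic] [W.IsGloballyMinimal] (p : ℕ) [Fact p.Prime]
    {N : ℕ} [NeZero N] {f : CuspForm (CongruenceSubgroup.Gamma0 N) 2}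
    (hKato : kato_selmerCorank_le_order_padicLFunction W p (f := f))
    (hp2 : p ≠ 2) (hord : IsOrdinaryAt W p) (hf : IsNewformOf W f)
    (k : ℕ) (hk : k ≤ W.mordellWeilRank) :
    (k : ℕ∞) ≤ (padicLFunction f (unitRoot W p : ℚ_[p])).order := by
  have h1 : (W.selmerCorank p : ℕ∞) ≤ (padicLFunction f (unitRoot W p : ℚ_[p])).order :=
    hKato hp2 hord hf
  have hid : W.selmerCorank p = W.mordellWeilRank + W.shaCorank p :=
    W.selmerCorank_eq_mordellWeilRank_add_holds p
  have hk' : k ≤ W.selmerCorank p := by omega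
  have hk'' : (k : ℕ∞) ≤ (W.selmerCorank p : ℕ∞) := by exact_mod_cast hk'
  exact hk''.trans h1

/-! ### Symmetry of the doors -/

/-- **(α) and the lower inequality give (β) and RANK.** If `corank Sel_{p^∞}(E) ≤ r_an(E)` (door (α)
at `p`) and `r_an(E) ≤ rank E(ℚ)`, then `corank Ш(E)[p^∞] = 0` and `rank = r_an` (corank identity).
So any proof of RANK passing through (α) proves finiteness of `Ш[p^∞]` at that prime as a
corollary. [cite: GreenbergLNM1716, §1] -/
theorem soloInformed_sha_zero_and_rank_eq_of_cap_of_lb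
    (W : WeierstrassCurve ℚ) [W.IsElliptic] (p : ℕ) [Fact p.Prime]
    (hα : W.selmerCorank p ≤ W.analyticRank) (hLB : W.analyticRank ≤ W.mordellWeilRank) :
    W.shaCorank p = 0 ∧ W.mordellWeilRank = W.analyticRank := by
  have hid : W.selmerCorank p = W.mordellWeilRank + W.shaCorank p :=
    W.selmerCorank_eq_mordellWeilRank_add_holds p
  omega

/-- **(β) and a Selmer lower bound give the lower inequality.** [cite: GreenbergLNM1716, §1] -/
theorem soloInformed_lb_of_sha_zero_of_selmer_lb
    (W : WeierstrassCurve ℚ) [W.IsElliptic] (p : ℕ) [Fact p.Prime]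
    (hβ : W.shaCorank p = 0) (hSel : W.analyticRank ≤ W.selmerCorank p) :
    W.analyticRank ≤ W.mordellWeilRank := by
  have hid : W.selmerCorank p = W.mordellWeilRank + W.shaCorank p :=
    W.selmerCorank_eq_mordellWeilRank_add_holds p
  omega

/-- **RANK and (β) give (α)**, so (α) is necessary for any proof that also yields `Ш(p)`-finiteness.
[cite: GreenbergLNM1716, §1] -/
theorem soloInformed_cap_of_rank_eq_of_sha_zero
    (W : WeierstrassCurve ℚ) [W.IsElliptic] (p : ℕ) [Fact p.Prime]
    (h : W.mordellWeilRank = W.analyticRank) (hβ : W.shaCorank p = 0) :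
    W.selmerCorank p ≤ W.analyticRank := by
  have hid : W.selmerCorank p = W.mordellWeilRank + W.shaCorank p :=
    W.selmerCorank_eq_mordellWeilRank_add_holds p
  omega

/-- **Doors symmetry.** Once the ANALYTIC identity `corank Sel_{p^∞}(E) = r_an(E)` is pinned at a
prime `p` (door (α) plus the converse ladder and `p`-parity, all statements comparing `L`-data with
Selmer data), the three ARITHMETIC statements coincide: `Ш(E)[p^∞]` has corank `0` ⟺ the lower
inequality `r_an ≤ rank` ⟺ RANK at `E`. In particular, modulo the analytic identity, "finiteness of
`Ш[p^∞]` without a point" and "existence of `r_an` independent points" are the same problem.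
[cite: GreenbergLNM1716, §1] -/
theorem soloInformed_doors_symmetry
    (W : WeierstrassCurve ℚ) [W.IsElliptic] (p : ℕ) [Fact p.Prime]
    (hc : W.selmerCorank p = W.analyticRank) :
    (W.shaCorank p = 0 ↔ W.analyticRank ≤ W.mordellWeilRank) ∧
    (W.shaCorank p = 0 ↔ W.mordellWeilRank = W.analyticRank) := by
  have hid : W.selmerCorank p = W.mordellWeilRank + W.shaCorank p :=
    W.selmerCorank_eq_mordellWeilRank_add_holds p
  constructor <;> constructor <;> intro h <;> omega

/-! ### Door (α) at analytic rank two in the good ordinary chart: ONE non-vanishing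

At a good ordinary prime `p ∤ N_E` the `p`-adic order of vanishing is already `≥ 2` when
`r_an(E) = 2` — parity transfer, interpolation and Rohrlich, all proved in-tree
(`analyticRank_le_order_padicLFunction_of_le_two`). Hence door (α) at rank two is literally the
non-vanishing of one `p`-adic number, the second Taylor coefficient of `L_p(E,T)`, and together
with Kato's bound it closes the upper inequality at `E`. What is NOT known is any implication
`L''(E,1) ≠ 0 ⟹ ∃ p, coeff₂ L_p(E,T) ≠ 0` (door (α) proper). -/

section AlphaTwo

variable (W : WeierstrassCurve ℚ) [W.IsElliptic] [W.IsGloballyMinimal] [NeZero (W.conductorNorm ℤ)]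
  {f : CuspForm (CongruenceSubgroup.Gamma0 (W.conductorNorm ℤ)) 2} (p : ℕ) [Fact p.Prime]

/-- At `r_an = 2` and a good ordinary `p ∤ N_E`: `ord_T L_p ≤ 2 ↔ ord_T L_p = 2` (the lower bound
`ord_T L_p ≥ 2` is the in-tree parity transfer). [cite: MazurTateTeitelbaum1986Invent, §I.17] -/
theorem soloInformed_order_le_two_iff_eq_two (hf : IsNewformOf W f)
    (hpN : ¬ p ∣ W.conductorNorm ℤ) (hord : IsOrdinaryAt W p) (h2 : W.analyticRank = 2) :
    (padicLFunction f (unitRoot W p : ℚ_[p])).order ≤ 2 ↔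
      (padicLFunction f (unitRoot W p : ℚ_[p])).order = 2 := by
  have hge : (2 : ℕ∞) ≤ (padicLFunction f (unitRoot W p : ℚ_[p])).order := by
    have h := analyticRank_le_order_padicLFunction_of_le_two W p hf hpN hord h2.le
    rw [h2] at h
    exact_mod_cast h
  exact ⟨fun h ↦ le_antisymm h hge, fun h ↦ h.le⟩

/-- At `r_an = 2` and a good ordinary `p ∤ N_E`, door (α) `ord_T L_p(E,T) ≤ 2` is the
non-vanishing of the second Taylor coefficient of the Mazur–Swinnerton-Dyer `p`-adic `L`-function.
[cite: MazurTateTeitelbaum1986Invent, §I.17] -/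
theorem soloInformed_order_le_two_iff_coeff_two_ne_zero (hf : IsNewformOf W f)
    (hpN : ¬ p ∣ W.conductorNorm ℤ) (hord : IsOrdinaryAt W p) (h2 : W.analyticRank = 2) :
    (padicLFunction f (unitRoot W p : ℚ_[p])).order ≤ 2 ↔
      PowerSeries.coeff 2 (padicLFunction f (unitRoot W p : ℚ_[p])) ≠ 0 := by
  constructor
  · intro h
    have h' := (soloInformed_order_le_two_iff_eq_two W p hf hpN hord h2).mp h
    have h'' : (padicLFunction f (unitRoot W p : ℚ_[p])).order = (2 : ℕ) := by
      exact_mod_cast h'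
    exact (PowerSeries.order_eq_nat.mp h'').1
  · intro h
    exact_mod_cast PowerSeries.order_le 2 h

/-- **UB at a rank-two curve from one `p`-adic non-vanishing.** Kato's bound at an odd good ordinary
prime plus `coeff₂ L_p(E,T) ≠ 0` give `rank E(ℚ) ≤ 2` — no hypothesis on `r_an` is needed for this
direction. [cite: Kato2004, Thm 18.4] -/
theorem soloInformed_rank_le_two_of_coeff_two_ne_zero
    (hKato : kato_selmerCorank_le_order_padicLFunction W p (f := f)) (hp2 : p ≠ 2)
    (hord : IsOrdinaryAt W p) (hf : IsNewformOf W f)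
    (h : PowerSeries.coeff 2 (padicLFunction f (unitRoot W p : ℚ_[p])) ≠ 0) :
    W.mordellWeilRank ≤ 2 := by
  have h1 := soloInformed_points_force_padic_vanishing W p hKato hp2 hord hf W.mordellWeilRank
    le_rfl
  have h2 : (padicLFunction f (unitRoot W p : ℚ_[p])).order ≤ 2 := by
    exact_mod_cast PowerSeries.order_le 2 h
  have : (W.mordellWeilRank : ℕ∞) ≤ 2 := h1.trans h2
  exact_mod_cast this

/-- **RANK at a rank-two curve from (α)+(β) in the good ordinary chart, sharpest form.**
`r_an(E) = 2`, an odd good ordinary `p ∤ N_E` with `coeff₂ L_p(E,T) ≠ 0` (door (α)) and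
`corank Ш(E)[p^∞] = 0` (door (β)), plus the Selmer lower bound `2 ≤ corank Sel_{p^∞}(E)` (in print:
main conjecture + corank-one converse + parity, see `SoloInformedConverseLadder`) give
`rank E(ℚ) = 2`. [cite: Kato2004, Thm 18.4] [cite: GreenbergLNM1716, §1] -/
theorem soloInformed_rank_eq_two_of_coeff_two_ne_zero_of_sha_zero
    (hKato : kato_selmerCorank_le_order_padicLFunction W p (f := f)) (hp2 : p ≠ 2)
    (hord : IsOrdinaryAt W p) (hf : IsNewformOf W f) (h2 : W.analyticRank = 2)
    (hα : PowerSeries.coeff 2 (padicLFunction f (unitRoot W p : ℚ_[p])) ≠ 0)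
    (hβ : W.shaCorank p = 0) (hSel : 2 ≤ W.selmerCorank p) :
    W.mordellWeilRank = W.analyticRank := by
  have hub := soloInformed_rank_le_two_of_coeff_two_ne_zero W p hKato hp2 hord hf hα
  have hid : W.selmerCorank p = W.mordellWeilRank + W.shaCorank p :=
    W.selmerCorank_eq_mordellWeilRank_add_holds p
  omega

end AlphaTwo

/-! ### The order part of p-adic BSD at ONE prime plus door (α) gives RANK and (β)

For a curve whose Selmer lower bound `r_an ≤ corank Sel_{p^∞}` is available (in print for
`r_an ≤ 3`: main conjecture, corank-one converse, parity — see `SoloInformedConverseLadder`), the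
ORDER statement of the Mazur–Tate–Teitelbaum `p`-adic BSD conjecture at a single odd good ordinary
prime, `ord_T L_p(E,T) = rank E(ℚ)`, together with the MTT inequality `ord_T L_p(E,T) ≤ ord_{s=1}
L(E,s)` (door (α) on the `p`-adic side), yields classical RANK at `E` AND `corank Ш(E)[p^∞] = 0`.
So door (β) is implied by `p`-adic BSD (order part) at that prime; the converse direction needs (α). -/

/-- **RANK and (β) from p-adic BSD (order part) + (α) at one prime.**
[cite: MazurTateTeitelbaum1986Invent, §II.10] [cite: Kato2004, Thm 18.4] -/
theorem soloInformed_rank_eq_and_sha_zero_of_padicOrder_eq_rank_of_alpha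
    (W : WeierstrassCurve ℚ) [W.IsElliptic] [W.IsGloballyMinimal] (p : ℕ) [Fact p.Prime]
    {N : ℕ} [NeZero N] {f : CuspForm (CongruenceSubgroup.Gamma0 N) 2}
    (hKato : kato_selmerCorank_le_order_padicLFunction W p (f := f))
    (hp2 : p ≠ 2) (hord : IsOrdinaryAt W p) (hf : IsNewformOf W f)
    (hpBSD : (padicLFunction f (unitRoot W p : ℚ_[p])).order = W.mordellWeilRank)
    (hα : (padicLFunction f (unitRoot W p : ℚ_[p])).order ≤ W.analyticRank)
    (hSel : W.analyticRank ≤ W.selmerCorank p) :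
    W.mordellWeilRank = W.analyticRank ∧ W.shaCorank p = 0 := by
  have h1 : (W.selmerCorank p : ℕ∞) ≤ (padicLFunction f (unitRoot W p : ℚ_[p])).order :=
    hKato hp2 hord hf
  have hid : W.selmerCorank p = W.mordellWeilRank + W.shaCorank p :=
    W.selmerCorank_eq_mordellWeilRank_add_holds p
  rw [hpBSD] at h1 hα
  have h1' : W.selmerCorank p ≤ W.mordellWeilRank := by exact_mod_cast h1
  have hα' : W.mordellWeilRank ≤ W.analyticRank := by exact_mod_cast hα
  omega

end Summit.BirchSwinnertonDyer.BirchSwinnertonDyer.Theorems
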